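import Mathlib
import Literature.Analysis.FluidPDE.BoundedLerayHopfClay
import Literature.Analysis.FluidPDE.LeraySuitableWeakSolutions
import Literature.Analysis.FluidPDE.PartialRegularityHolds
import Literature.Analysis.FluidPDE.NSCriticalClosureBesovKatoClass
import Literature.Analysis.FluidPDE.SuitableWeakProofs
import Literature.Analysis.FluidPDE.LocalTypeI
import HarnessLib

/-!
# Route RootDecompLitSlice — brick B0 of the aside D₁ `DarkBallSpreads`
  (stmt-NavierStokesRegularity-29566; crux D `NoDarkBall` stmt-29563 is `{stub_darkBallSpreads}` = D₁ by
  name, `Theorems/RootDecompLitSliceNoDarkBallCompositionModuloStub.lean`)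

**TERMINAL-TIME NULLITY.** For `ν > 0`, `T > 0` and a classical solution `(u, p)` of the unforced
Navier–Stokes system on `[0, T) × ℝ³` which is Leray–Hopf on `[0, T]` from the rapidly decaying datum
`u 0` (the hypothesis class of D₁, minus maximality), the set of BACKWARD-singular points of the terminal
slice,
`Σ_T = {x : ℝ³ | (T, x) is a backward singular point of u}` (tree `IsBackwardSingularPoint`:
`‖u‖_{L^∞(Q_r(T, x))} = ∞` for every `r > 0`, `Q_r(T, x) = (T − r², T) × B_r(x)`),
satisfies `𝒫¹({T} × Σ_T) = 0` (parabolic Hausdorff measure) and `ℋ¹(Σ_T) = 0`.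

The census g27 addendum (HOME/census/gen-v27/ADDENDUM_g27.json, bus L1155; critic row 328) recorded that
the tree's CKN ε-regularity / Theorem B are INTERIOR statements (centred cylinders in an open region) and
booked the terminal-time nullity as a missing brick whose glue route needed «a suitable weak solution from
L² data» existence decl, reported as not located. It IS in the tree, and the brick is pure assembly:

* `exists_isGlobalLerayHopf_and_isLocalEnergySolutionOn` (`LeraySuitableWeakSolutions.lean`; Leray 1934 +
  CKN 1982 Appendix «Leray's solutions are suitable»): the datum `u 0 ∈ L²`, weakly divergence free,
  launches a GLOBAL Leray–Hopf weak solution `v` that is a local energy (CKN-suitable) solution on every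
  strip `(0, S) × ℝ³`;
* `isKatoSolutionOn_of_classical` + `IsGlobalLerayHopf.ae_eq_uncurry_of_isKatoSolutionOn_of_decay`
  (`BoundedLerayHopfClay.lean`; Prodi–Serrin weak–strong uniqueness through the Tao class): `v = u` a.e. on
  `(0, T) × ℝ³` — no gluing at `T`, no energy continuity at `T`;
* `ckn_partial_regularity_holds` (CKN 1982 Theorem B, PROVED in the tree) on the open slab
  `(0, T+1) × ℝ³`: the (centred) singular set of `v` there is `𝒫¹`-null;
* a backward-singular point `(T, x)` of `u` is a singular point of `v` (a centred cylinder about `(T, x)`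
  on which `v` is bounded contains a small backward cylinder, inside `(0,T) × ℝ³`, where `v = u` a.e.);
* `IsParabolicNull.hausdorffMeasure_eq_zero_holds` (`𝒫¹`-null ⇒ `ℋ¹`-null in space–time) and the
  isometric embedding `x ↦ (T, x)` (`Isometry.hausdorffMeasure_image`).

HONEST FRAMING: bookkeeping about a HYPOTHETICAL singular time over proved tree theorems; it closes no
item (D₁ needs further bricks: regular-point smoothing up to `T`, flatness ⟹ infinite order, unique
continuation, connectivity / removability, Weyl). Nothing here bears on NS regularity (rung 0).
Lands `--supports stmt-NavierStokesRegularity-29566` (census instrument decomp-ns-census-1 g28).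
-/

noncomputable section

open MeasureTheory Set Function Filter Topology Metric TopologicalSpace
open scoped ENNReal NNReal ContDiff
open Literature.Analysis Literature.Analysis.FluidPDE

-- the summit and its single sub-problem share the name (CONVENTIONS §1), as in every Theorems file
set_option linter.dupNamespace false

namespace Summit.NavierStokesRegularity.NavierStokesRegularity.Theorems

/-- **A backward-singular terminal point of the classical solution is a (centred) singular point of every
global Leray–Hopf continuation that agrees with it a.e. below `T`.** If `v = u` a.e. on `(0,T) × ℝ³` and
`(T, x)` is a backward singular point of `u` (`IsBackwardSingularPoint`: essentially unbounded on every
backward cylinder `Q_r(T, x)`), then `(T, x)` is not a regular point of `v` (CKN 1982 §6: essentially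
bounded on a centred cylinder) — only small radii matter, and small backward cylinders at `(T, x)` lie in
`(0,T) × ℝ³` (compare the tree's `IsBackwardSingularPoint.congr_ae`, which asks all backward cylinders to
lie in the set of agreement). [this file] -/
theorem not_isRegularPoint_of_isBackwardSingularPoint_of_ae_eq {T : ℝ} (hT : 0 < T)
    {u v : ℝ → (EuclideanSpace ℝ (Fin 3)) → (EuclideanSpace ℝ (Fin 3))} (hae : uncurry v =ᵐ[volume.restrict (Ioo 0 T ×ˢ (univ : Set (EuclideanSpace ℝ (Fin 3))))] uncurry u)
    {x : (EuclideanSpace ℝ (Fin 3))} (hx : IsBackwardSingularPoint u ((T : ℝ), x)) : ¬ IsRegularPoint v ((T : ℝ), x) := by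
  rintro ⟨r, hr, hbd⟩
  -- a radius `r' ≤ r` with `r'² < T`
  obtain ⟨r', hr', hr'r, hr'T⟩ : ∃ r' : ℝ, 0 < r' ∧ r' ≤ r ∧ r' ^ 2 < T := by
    refine ⟨min r (min 1 (T / 2)), by positivity, min_le_left _ _, ?_⟩
    have h1 : min r (min 1 (T / 2)) ≤ 1 := (min_le_right _ _).trans (min_le_left _ _)
    have h2 : min r (min 1 (T / 2)) ≤ T / 2 := (min_le_right _ _).trans (min_le_right _ _)
    have h0 : 0 < min r (min 1 (T / 2)) := by positivity
    nlinarith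
  -- `Q_{r'}(T, x) ⊆ Q*_r(T, x)` and `Q_{r'}(T, x) ⊆ (0, T) × ℝ³`
  have hsub1 : parabolicCylinder r' ((T : ℝ), x) ⊆ parabolicCylinderCentered r ((T : ℝ), x) := by
    intro w hw
    rw [mem_parabolicCylinder] at hw
    rw [mem_parabolicCylinderCentered]
    have hsq : r' ^ 2 ≤ r ^ 2 := by nlinarith
    refine ⟨⟨by linarith [hw.1.1], by nlinarith [hw.1.2, sq_nonneg r]⟩, lt_of_lt_of_le hw.2 hr'r⟩
  have hsub2 : parabolicCylinder r' ((T : ℝ), x) ⊆ Ioo 0 T ×ˢ (univ : Set (EuclideanSpace ℝ (Fin 3))) := by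
    rintro ⟨t, y⟩ hw
    rw [mem_parabolicCylinder] at hw
    exact ⟨⟨by simp only at hw; linarith [hw.1.1], by simpa using hw.1.2⟩, mem_univ _⟩
  have hv' : eLpNorm (uncurry v) ⊤ (volume.restrict (parabolicCylinder r' ((T : ℝ), x))) < ⊤ :=
    lt_of_le_of_lt (eLpNorm_mono_measure _ (Measure.restrict_mono hsub1 le_rfl)) hbd
  have hae' : uncurry v =ᵐ[volume.restrict (parabolicCylinder r' ((T : ℝ), x))] uncurry u :=
    ae_restrict_of_ae_restrict_of_subset hsub2 hae
  rw [eLpNorm_congr_ae hae'] at hv'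
  exact hv'.ne (hx r' hr')

/-- **Brick B0, parabolic form: `𝒫¹({T} × Σ_T) = 0`.** For `ν > 0`, `T > 0`, a classical unforced
Navier–Stokes solution `(u, p)` on `[0, T) × ℝ³` that is Leray–Hopf on `[0, T]` from the rapidly decaying
datum `u 0`, the terminal backward-singular slice `{T} × Σ_T` is `𝒫¹`-null: it lies in the singular set
of the CKN-suitable global Leray–Hopf solution from `u 0` (`exists_isGlobalLerayHopf_and_isLocalEnergySolutionOn`),
which agrees with `u` a.e. below `T` (`IsGlobalLerayHopf.ae_eq_uncurry_of_isKatoSolutionOn_of_decay`), and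
CKN Theorem B (`ckn_partial_regularity_holds`) applies on the open slab `(0, T+1) × ℝ³`.
[cite: CaffarelliKohnNirenberg1982, §6 Theorem B and Appendix] [cite: LemarieRieusset2016, Prop. 12.3, Thm. 15.1] -/
theorem isParabolicNull_terminal_backwardSingularSlice {ν T : ℝ} (hν : 0 < ν) (hT : 0 < T)
    {u : ℝ → (EuclideanSpace ℝ (Fin 3)) → (EuclideanSpace ℝ (Fin 3))} {p : ℝ → (EuclideanSpace ℝ (Fin 3)) → ℝ} (hsol : IsClassicalNSSolutionOn (Ico 0 T) ν 0 u p)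
    (hLH : IsLerayHopfOn T ν 0 (u 0) u) (hdec : HasRapidSpatialDecay (u 0)) :
    IsParabolicNull 1 (({T} : Set ℝ) ×ˢ {x : (EuclideanSpace ℝ (Fin 3)) | IsBackwardSingularPoint u ((T : ℝ), x)}) := by
  -- the datum is smooth, divergence free, in `L²`, weakly divergence free
  have h0 : (0 : ℝ) ∈ Ico 0 T := ⟨le_rfl, hT⟩
  have hu₀ : ContDiff ℝ ∞ (u 0) := hsol.contDiff_velocity h0
  have hdiv : VectorCalculus.IsDivFree (u 0) := hsol.divFree 0 h0
  have hwdiv : IsWeaklyDivFree (u 0) := hLH.isWeaklyDivFree_datum hT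
  have hu02 : MemLp (u 0) 2 volume := hLH.memLp 0 ⟨le_rfl, hT.le⟩
  -- `u` is the Kato solution of its datum on `[0, T)`
  have hK : IsKatoSolutionOn T ν (u 0) u := isKatoSolutionOn_of_classical hν hT hsol hLH hdec
  -- the CKN-suitable global Leray–Hopf solution from `u 0`
  obtain ⟨v, q, hG, -, -, -, -, -, hLE⟩ :=
    exists_isGlobalLerayHopf_and_isLocalEnergySolutionOn hν hu02 hwdiv
  -- it agrees with `u` a.e. on `(0, T) × ℝ³`
  have hae : uncurry v =ᵐ[volume.restrict (Ioo 0 T ×ˢ (univ : Set (EuclideanSpace ℝ (Fin 3))))] uncurry u :=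
    hG.ae_eq_uncurry_of_isKatoSolutionOn_of_decay hν hu₀ hdiv hdec hT hK
  -- CKN Theorem B on the open slab `(0, T+1) × ℝ³`
  have hT1 : 0 < T + 1 := by linarith
  have hsuit : IsSuitableWeakSolutionOn (slab (EuclideanSpace ℝ (Fin 3)) (Ioo 0 (T + 1)) isOpen_Ioo) ν 0 v q :=
    (hLE (T + 1) hT1).suitable
  have hnull : IsParabolicNull 1
      (singularSet v ((slab (EuclideanSpace ℝ (Fin 3)) (Ioo 0 (T + 1)) isOpen_Ioo : Opens (ℝ × (EuclideanSpace ℝ (Fin 3)))) : Set (ℝ × (EuclideanSpace ℝ (Fin 3))))) :=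
    ckn_partial_regularity_holds _ hν hsuit (isCKNForceOn_zero _)
  -- the terminal backward-singular slice lies in that singular set
  refine hnull.mono ?_
  rintro ⟨t, x⟩ ⟨ht, hx⟩
  have ht' : t = T := by simpa using ht
  subst ht'
  refine ⟨?_, not_isRegularPoint_of_isBackwardSingularPoint_of_ae_eq hT hae hx⟩
  change ((t, x) : ℝ × (EuclideanSpace ℝ (Fin 3))) ∈ (Ioo 0 (t + 1)) ×ˢ (univ : Set (EuclideanSpace ℝ (Fin 3)))
  exact ⟨⟨hT, by linarith⟩, mem_univ _⟩

/-- **Brick B0: `ℋ¹(Σ_T) = 0` — the backward-singular set of the terminal slice of a Clay-class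
classical solution on `[0, T)` has one-dimensional Hausdorff measure zero** (from the parabolic form by
`IsParabolicNull.hausdorffMeasure_eq_zero_holds` and the isometric embedding `x ↦ (T, x)` of `ℝ³` into
`ℝ × ℝ³` with the sup metric). [cite: CaffarelliKohnNirenberg1982, §6 Theorem B, §2 remark after (2.6)] -/
theorem hausdorffMeasure_terminal_backwardSingularSlice_eq_zero {ν T : ℝ} (hν : 0 < ν) (hT : 0 < T)
    {u : ℝ → (EuclideanSpace ℝ (Fin 3)) → (EuclideanSpace ℝ (Fin 3))} {p : ℝ → (EuclideanSpace ℝ (Fin 3)) → ℝ} (hsol : IsClassicalNSSolutionOn (Ico 0 T) ν 0 u p)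
    (hLH : IsLerayHopfOn T ν 0 (u 0) u) (hdec : HasRapidSpatialDecay (u 0)) :
    μH[1] {x : (EuclideanSpace ℝ (Fin 3)) | IsBackwardSingularPoint u ((T : ℝ), x)} = 0 := by
  have h := IsParabolicNull.hausdorffMeasure_eq_zero_holds one_pos
    (isParabolicNull_terminal_backwardSingularSlice hν hT hsol hLH hdec)
  have hiso : Isometry (Prod.mk (T : ℝ) : (EuclideanSpace ℝ (Fin 3)) → ℝ × (EuclideanSpace ℝ (Fin 3))) :=
    Isometry.of_dist_eq fun x y => by rw [Prod.dist_eq, dist_self, max_eq_right dist_nonneg]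
  rw [singleton_prod, hiso.hausdorffMeasure_image (Or.inl zero_le_one)] at h
  exact h

/-- **Brick B0 in the binder shape of the aside D₁ `DarkBallSpreads` (stmt-NavierStokesRegularity-29566)
and of the crux D `NoDarkBall` (stmt-29563)**: for a maximal smooth solution with lifespan `T`, Leray–Hopf
on `[0, T]` from a rapidly decaying datum, `ℋ¹` of the backward-singular set of the terminal slice is
zero. (Maximality is not used.) [this file] -/
theorem darkBall_terminalSlice_singularSet_null :
    ∀ (ν T : ℝ), 0 < ν → 0 < T → ∀ (u : ℝ → (EuclideanSpace ℝ (Fin 3)) → (EuclideanSpace ℝ (Fin 3))) (p : ℝ → (EuclideanSpace ℝ (Fin 3)) → ℝ),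
      IsMaximalSmoothSolution ν 0 u p T → IsLerayHopfOn T ν 0 (u 0) u → HasRapidSpatialDecay (u 0) →
      μH[1] {x : (EuclideanSpace ℝ (Fin 3)) | IsBackwardSingularPoint u ((T : ℝ), x)} = 0 :=
  fun _ _ hν hT _ _ hmax hLH hdec =>
    hausdorffMeasure_terminal_backwardSingularSlice_eq_zero hν hT hmax.1 hLH hdec

end Summit.NavierStokesRegularity.NavierStokesRegularity.Theorems
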